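import Summits.ValiantsHypothesis.ValiantsHypothesis.Theorems.BarrierLeverChowThinRowsScaledPairs

/-!
# Route BarrierLever — item `ChowHitsThinRowPartitionMinors` (stmt-ValiantsHypothesis-20195):
# leave-two-out products and LABELLED rows for scaled indicator designs (pair-layer bookkeeping, II)

Helper file (`--supports stmt-ValiantsHypothesis-20195`; cell valiant-natproofs, rung V4, 𝒟-side of
door (c); prover seat val-np-p7 gen 4).  Closes NO item; imports only `…ChowThinRowsScaledPairs`
(val-np-p7 g4); no definitions.

Forms `φ_V = C 1 + Σ_a C (κ a V) x_a + Σ_c C (γ V c) y_c` over `V ∈ 𝒦`, `t_V` the truncated inverse of the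
`y`-part `φ⁰_V` (`…ScaledForms`).  For the LABELLED design `κ a V = [V = L a]` (each `x_a` sits in the one
form indexed by its label `L a ∈ 𝒦`):
* `coeff_leaveTwoOutG` — `coeff (E ∅ W) ∏_{𝒦 ∖ {V, V'}} φ⁰ = Σ_{X ⊆ W} coeff (E ∅ (W ∖ X)) ∏_𝒦 φ⁰ · coeff (E ∅ X) (t_V t_{V'})`
  (`V ≠ V'`; the leave-one-out closed form `coeff_leaveOneOutG` applied twice);
* `coeff_single_prod_label` / `coeff_pair_prod_label` — the singleton row `{a}` of the partition matrix is
  the leave-`L a`-out coefficient, the pair row `{a, b}` (`L a ≠ L b`) the leave-`{L a, L b}`-out one;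
* `coeff_tprod_eq_zero` / `coeff_tprod_top` — `t_V · t_{V'}` is supported on the subsets of `V ∪ V'`
  and, for DISJOINT `V, V'`, its coefficient at `y^{V ∪ V'}` is `t_V(V) · t_{V'}(V') ≠ 0`.
These are the inputs of the transfer principle of memo MEMO-CPM-pairlayer-pointers-v7 (val-np-p7 g4):
labelled pair designs factor as `M_W = P(ε) · B̃_ε(Δ, W)` over a down-closed monomial basis `Δ`.

WHAT THIS IS NOT: bookkeeping only; no statement about the pair layer is proved here; nothing on
items 20172 / 19717, on crux stmt-ValiantsHypothesis-14610, or on `VP` versus `VNP`.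
-/

set_option linter.dupNamespace false

namespace Summit.ValiantsHypothesis.ValiantsHypothesis.Theorems.BarrierLever.ChowThinAll

open Finset MvPolynomial
open Summit.ValiantsHypothesis.ValiantsHypothesis.Theorems.BarrierLever.ChowFactor
  (coeff_partitionExpo_mul_affine coeff_partitionExpo_mul_yOnly)
open Summit.ValiantsHypothesis.ValiantsHypothesis.Theorems.BarrierLever.ProductStateSums
  (castAdd_ne_natAdd partitionExpo_apply_castAdd partitionExpo_apply_natAdd)
open Summit.ValiantsHypothesis.ValiantsHypothesis.Theorems.BarrierLever.CorankRepair (partitionExpo_eq_iff)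

variable {h : ℕ}

/-! ## 1. Leave-two-out products -/

/-- Multiplying a `y`-only `Q` by `t_V · φ⁰_V` does not change its squarefree `x`-free coefficients
(`t_V · φ⁰_V ≡ 1`). -/
theorem coeff_mul_tinv_mul_form0G (γ : Finset (Fin h) → Fin h → ℂ) (V : Finset (Fin h))
    (hγ : ∀ c, c ∉ V → γ V c = 0) (Q : MvPolynomial (Fin (h + h)) ℂ) (W : Finset (Fin h)) :
    coeff (∑ a ∈ (∅ : Finset (Fin h)), Finsupp.single (Fin.castAdd h a) 1 +
        ∑ c ∈ W, Finsupp.single (Fin.natAdd h c) 1)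
        (Q * ((∑ U ∈ V.powerset, monomial (∑ a ∈ (∅ : Finset (Fin h)), Finsupp.single (Fin.castAdd h a) 1 +
            ∑ c ∈ U, Finsupp.single (Fin.natAdd h c) 1)
            ((-1 : ℂ) ^ U.card * (U.card.factorial : ℂ) * ∏ c ∈ U, γ V c)) *
          (C 1 + ∑ a, C ((fun (_ : Fin h) (_ : Finset (Fin h)) => (0 : ℂ)) a V) * X (Fin.castAdd h a) +
            ∑ c, C (γ V c) * X (Fin.natAdd h c)))) =
      coeff (∑ a ∈ (∅ : Finset (Fin h)), Finsupp.single (Fin.castAdd h a) 1 +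
        ∑ c ∈ W, Finsupp.single (Fin.natAdd h c) 1) Q := by
  classical
  rw [coeff_partitionExpo_mul_yOnly _ _ (ChowSubcube.yOnly_mul (yOnly_tinvG γ V) (yOnly_form0G γ V)) ∅ W]
  simp_rw [coeff_tinv_mul_form0G γ V hγ, mul_ite, mul_one, mul_zero]
  rw [Finset.sum_ite_eq', if_pos (Finset.empty_mem_powerset W), Finset.sdiff_empty]

/-- **Closed form for the leave-two-out products**: for `V ≠ V'` in `𝒦` with `γ V`, `γ V'` supported
in `V`, `V'`,
`coeff (E ∅ W) ∏_{(𝒦 ∖ V) ∖ V'} φ⁰ = Σ_{X ⊆ W} coeff (E ∅ (W ∖ X)) (∏_𝒦 φ⁰) · coeff (E ∅ X) (t_V · t_{V'})`. -/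
theorem coeff_leaveTwoOutG (γ : Finset (Fin h) → Fin h → ℂ) (𝒦 : Finset (Finset (Fin h)))
    (V V' : Finset (Fin h)) (hV : V ∈ 𝒦) (hV' : V' ∈ 𝒦) (hVV' : V ≠ V')
    (hγ : ∀ c, c ∉ V → γ V c = 0) (hγ' : ∀ c, c ∉ V' → γ V' c = 0) (W : Finset (Fin h)) :
    coeff (∑ a ∈ (∅ : Finset (Fin h)), Finsupp.single (Fin.castAdd h a) 1 +
        ∑ c ∈ W, Finsupp.single (Fin.natAdd h c) 1)
        (∏ V'' ∈ (𝒦.erase V).erase V', (C 1 + ∑ a, C ((fun (_ : Fin h) (_ : Finset (Fin h)) => (0 : ℂ)) a V'') *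
            X (Fin.castAdd h a) + ∑ c, C (γ V'' c) * X (Fin.natAdd h c))) =
      ∑ X' ∈ W.powerset,
        coeff (∑ a ∈ (∅ : Finset (Fin h)), Finsupp.single (Fin.castAdd h a) 1 +
            ∑ c ∈ W \ X', Finsupp.single (Fin.natAdd h c) 1)
          (∏ V'' ∈ 𝒦, (C 1 + ∑ a, C ((fun (_ : Fin h) (_ : Finset (Fin h)) => (0 : ℂ)) a V'') *
            X (Fin.castAdd h a) + ∑ c, C (γ V'' c) * X (Fin.natAdd h c))) *
        coeff (∑ a ∈ (∅ : Finset (Fin h)), Finsupp.single (Fin.castAdd h a) 1 +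
            ∑ c ∈ X', Finsupp.single (Fin.natAdd h c) 1)
          ((∑ U ∈ V.powerset, monomial (∑ a ∈ (∅ : Finset (Fin h)), Finsupp.single (Fin.castAdd h a) 1 +
              ∑ c ∈ U, Finsupp.single (Fin.natAdd h c) 1)
              ((-1 : ℂ) ^ U.card * (U.card.factorial : ℂ) * ∏ c ∈ U, γ V c)) *
            (∑ U ∈ V'.powerset, monomial (∑ a ∈ (∅ : Finset (Fin h)), Finsupp.single (Fin.castAdd h a) 1 +
              ∑ c ∈ U, Finsupp.single (Fin.natAdd h c) 1)
              ((-1 : ℂ) ^ U.card * (U.card.factorial : ℂ) * ∏ c ∈ U, γ V' c))) := by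
  classical
  rw [← coeff_partitionExpo_mul_yOnly _ _ (ChowSubcube.yOnly_mul (yOnly_tinvG γ V) (yOnly_tinvG γ V')) ∅ W]
  have hV'e : V' ∈ 𝒦.erase V := Finset.mem_erase.mpr ⟨hVV'.symm, hV'⟩
  rw [← Finset.prod_erase_mul 𝒦 _ hV, ← Finset.prod_erase_mul (𝒦.erase V) _ hV'e]
  -- `((E · φ⁰_{V'}) · φ⁰_V) · (t_V · t_{V'}) = (E · (t_{V'} · φ⁰_{V'})) · (t_V · φ⁰_V)`
  set E2 := ∏ V'' ∈ (𝒦.erase V).erase V', (C 1 + ∑ a, C ((fun (_ : Fin h) (_ : Finset (Fin h)) => (0 : ℂ)) a V'') *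
      X (Fin.castAdd h a) + ∑ c, C (γ V'' c) * X (Fin.natAdd h c)) with hE2
  set fV := (C 1 + ∑ a, C ((fun (_ : Fin h) (_ : Finset (Fin h)) => (0 : ℂ)) a V) * X (Fin.castAdd h a) +
      ∑ c, C (γ V c) * X (Fin.natAdd h c) : MvPolynomial (Fin (h + h)) ℂ) with hfV
  set fV' := (C 1 + ∑ a, C ((fun (_ : Fin h) (_ : Finset (Fin h)) => (0 : ℂ)) a V') * X (Fin.castAdd h a) +
      ∑ c, C (γ V' c) * X (Fin.natAdd h c) : MvPolynomial (Fin (h + h)) ℂ) with hfV'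
  set tV := (∑ U ∈ V.powerset, monomial (∑ a ∈ (∅ : Finset (Fin h)), Finsupp.single (Fin.castAdd h a) 1 +
      ∑ c ∈ U, Finsupp.single (Fin.natAdd h c) 1)
      ((-1 : ℂ) ^ U.card * (U.card.factorial : ℂ) * ∏ c ∈ U, γ V c) : MvPolynomial (Fin (h + h)) ℂ) with htV
  set tV' := (∑ U ∈ V'.powerset, monomial (∑ a ∈ (∅ : Finset (Fin h)), Finsupp.single (Fin.castAdd h a) 1 +
      ∑ c ∈ U, Finsupp.single (Fin.natAdd h c) 1)
      ((-1 : ℂ) ^ U.card * (U.card.factorial : ℂ) * ∏ c ∈ U, γ V' c) : MvPolynomial (Fin (h + h)) ℂ) with htV'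
  have e : E2 * fV' * fV * (tV * tV') = (E2 * (tV' * fV')) * (tV * fV) := by ring
  rw [e, hfV, htV, coeff_mul_tinv_mul_form0G γ V hγ, htV', hfV', coeff_mul_tinv_mul_form0G γ V' hγ']

/-! ## 2. Labelled rows: `x_a` sits in the single form indexed by its label `L a` -/

/-- **Singleton row of a labelled design**: with `κ a V = [V = L a]` and `L a ∈ 𝒦`, the row `{a}` of
the partition matrix is the `x`-free coefficient of the leave-`L a`-out product of the `y`-parts. -/
theorem coeff_single_prod_label (L : Fin h → Finset (Fin h)) (γ : Finset (Fin h) → Fin h → ℂ)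
    (𝒦 : Finset (Finset (Fin h))) (a : Fin h) (ha : L a ∈ 𝒦) (W : Finset (Fin h)) :
    coeff (∑ a' ∈ ({a} : Finset (Fin h)), Finsupp.single (Fin.castAdd h a') 1 +
        ∑ c ∈ W, Finsupp.single (Fin.natAdd h c) 1)
        (∏ V ∈ 𝒦, (C 1 + ∑ a', C ((fun (a'' : Fin h) (V' : Finset (Fin h)) =>
            if V' = L a'' then (1 : ℂ) else 0) a' V) * X (Fin.castAdd h a') +
          ∑ c, C (γ V c) * X (Fin.natAdd h c))) =
      coeff (∑ a' ∈ (∅ : Finset (Fin h)), Finsupp.single (Fin.castAdd h a') 1 +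
          ∑ c ∈ W, Finsupp.single (Fin.natAdd h c) 1)
        (∏ V ∈ 𝒦.erase (L a), (C 1 + ∑ a', C ((fun (_ : Fin h) (_ : Finset (Fin h)) => (0 : ℂ)) a' V) *
            X (Fin.castAdd h a') + ∑ c, C (γ V c) * X (Fin.natAdd h c))) := by
  classical
  rw [coeff_single_prodG]
  have hterm : ∀ V ∈ 𝒦, (fun (a'' : Fin h) (V' : Finset (Fin h)) => if V' = L a'' then (1 : ℂ) else 0) a V *
      coeff (∑ a' ∈ (∅ : Finset (Fin h)), Finsupp.single (Fin.castAdd h a') 1 +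
          ∑ c ∈ W, Finsupp.single (Fin.natAdd h c) 1)
        (∏ V' ∈ 𝒦.erase V, (C 1 + ∑ a', C ((fun (a'' : Fin h) (V'' : Finset (Fin h)) =>
            if V'' = L a'' then (1 : ℂ) else 0) a' V') * X (Fin.castAdd h a') +
          ∑ c, C (γ V' c) * X (Fin.natAdd h c))) =
      if V = L a then coeff (∑ a' ∈ (∅ : Finset (Fin h)), Finsupp.single (Fin.castAdd h a') 1 +
          ∑ c ∈ W, Finsupp.single (Fin.natAdd h c) 1)
        (∏ V' ∈ 𝒦.erase V, (C 1 + ∑ a', C ((fun (_ : Fin h) (_ : Finset (Fin h)) => (0 : ℂ)) a' V') *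
            X (Fin.castAdd h a') + ∑ c, C (γ V' c) * X (Fin.natAdd h c))) else 0 := by
    intro V _
    by_cases hV : V = L a
    · simp only [hV, if_true, one_mul]
      exact coeff_empty_prod_eqG _ _ γ _ W
    · simp only [if_neg hV, zero_mul]
  rw [Finset.sum_congr rfl hterm, Finset.sum_ite_eq', if_pos ha]

/-- **Pair row of a labelled design**: with `κ a V = [V = L a]`, `a ≠ b`, `L a ≠ L b` both in `𝒦`, the
row `{a, b}` of the partition matrix is the `x`-free coefficient of the leave-`{L a, L b}`-out product. -/
theorem coeff_pair_prod_label (L : Fin h → Finset (Fin h)) (γ : Finset (Fin h) → Fin h → ℂ)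
    (𝒦 : Finset (Finset (Fin h))) {a b : Fin h} (hab : a ≠ b) (ha : L a ∈ 𝒦) (hb : L b ∈ 𝒦)
    (hLab : L a ≠ L b) (W : Finset (Fin h)) :
    coeff (∑ a' ∈ ({a, b} : Finset (Fin h)), Finsupp.single (Fin.castAdd h a') 1 +
        ∑ c ∈ W, Finsupp.single (Fin.natAdd h c) 1)
        (∏ V ∈ 𝒦, (C 1 + ∑ a', C ((fun (a'' : Fin h) (V' : Finset (Fin h)) =>
            if V' = L a'' then (1 : ℂ) else 0) a' V) * X (Fin.castAdd h a') +
          ∑ c, C (γ V c) * X (Fin.natAdd h c))) =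
      coeff (∑ a' ∈ (∅ : Finset (Fin h)), Finsupp.single (Fin.castAdd h a') 1 +
          ∑ c ∈ W, Finsupp.single (Fin.natAdd h c) 1)
        (∏ V ∈ (𝒦.erase (L a)).erase (L b), (C 1 + ∑ a', C ((fun (_ : Fin h) (_ : Finset (Fin h)) => (0 : ℂ)) a' V) *
            X (Fin.castAdd h a') + ∑ c, C (γ V c) * X (Fin.natAdd h c))) := by
  classical
  rw [coeff_pair_prodG _ γ 𝒦 hab]
  have hb' : L b ∈ 𝒦.erase (L a) := Finset.mem_erase.mpr ⟨hLab.symm, hb⟩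
  have hterm : ∀ V ∈ 𝒦, (fun (a'' : Fin h) (V' : Finset (Fin h)) => if V' = L a'' then (1 : ℂ) else 0) a V *
      coeff (∑ a' ∈ ({b} : Finset (Fin h)), Finsupp.single (Fin.castAdd h a') 1 +
          ∑ c ∈ W, Finsupp.single (Fin.natAdd h c) 1)
        (∏ V' ∈ 𝒦.erase V, (C 1 + ∑ a', C ((fun (a'' : Fin h) (V'' : Finset (Fin h)) =>
            if V'' = L a'' then (1 : ℂ) else 0) a' V') * X (Fin.castAdd h a') +
          ∑ c, C (γ V' c) * X (Fin.natAdd h c))) =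
      if V = L a then coeff (∑ a' ∈ ({b} : Finset (Fin h)), Finsupp.single (Fin.castAdd h a') 1 +
          ∑ c ∈ W, Finsupp.single (Fin.natAdd h c) 1)
        (∏ V' ∈ 𝒦.erase V, (C 1 + ∑ a', C ((fun (a'' : Fin h) (V'' : Finset (Fin h)) =>
            if V'' = L a'' then (1 : ℂ) else 0) a' V') * X (Fin.castAdd h a') +
          ∑ c, C (γ V' c) * X (Fin.natAdd h c))) else 0 := by
    intro V _
    by_cases hV : V = L a
    · simp only [hV, if_true, one_mul]
    · simp only [if_neg hV, zero_mul]
  rw [Finset.sum_congr rfl hterm, Finset.sum_ite_eq', if_pos ha]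
  exact coeff_single_prod_label L γ (𝒦.erase (L a)) b hb' W

/-! ## 3. Support and top coefficient of `t_V · t_{V'}` -/

/-- `t_V · t_{V'}` is supported on the subsets of `V ∪ V'`. -/
theorem coeff_tprod_eq_zero (γ : Finset (Fin h) → Fin h → ℂ) (V V' X' : Finset (Fin h))
    (hX : ¬ X' ⊆ V ∪ V') :
    coeff (∑ a ∈ (∅ : Finset (Fin h)), Finsupp.single (Fin.castAdd h a) 1 +
        ∑ c ∈ X', Finsupp.single (Fin.natAdd h c) 1)
        ((∑ U ∈ V.powerset, monomial (∑ a ∈ (∅ : Finset (Fin h)), Finsupp.single (Fin.castAdd h a) 1 +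
            ∑ c ∈ U, Finsupp.single (Fin.natAdd h c) 1)
            ((-1 : ℂ) ^ U.card * (U.card.factorial : ℂ) * ∏ c ∈ U, γ V c)) *
          (∑ U ∈ V'.powerset, monomial (∑ a ∈ (∅ : Finset (Fin h)), Finsupp.single (Fin.castAdd h a) 1 +
            ∑ c ∈ U, Finsupp.single (Fin.natAdd h c) 1)
            ((-1 : ℂ) ^ U.card * (U.card.factorial : ℂ) * ∏ c ∈ U, γ V' c))) = 0 := by
  classical
  rw [coeff_partitionExpo_mul_yOnly _ _ (yOnly_tinvG γ V') ∅ X']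
  refine Finset.sum_eq_zero fun X₁ hX₁ => ?_
  rw [coeff_tinvG, coeff_tinvG]
  by_cases h1 : X' \ X₁ ⊆ V
  · by_cases h2 : X₁ ⊆ V'
    · exfalso
      apply hX
      intro c hc
      by_cases hc1 : c ∈ X₁
      · exact Finset.mem_union_right _ (h2 hc1)
      · exact Finset.mem_union_left _ (h1 (Finset.mem_sdiff.mpr ⟨hc, hc1⟩))
    · rw [if_neg h2, mul_zero]
  · rw [if_neg h1, zero_mul]

/-- **Top coefficient**: for DISJOINT `V, V'`, the coefficient of `t_V · t_{V'}` at `y^{V ∪ V'}` is the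
product of the top coefficients `t_V(V) · t_{V'}(V')`. -/
theorem coeff_tprod_top (γ : Finset (Fin h) → Fin h → ℂ) (V V' : Finset (Fin h)) (hd : Disjoint V V') :
    coeff (∑ a ∈ (∅ : Finset (Fin h)), Finsupp.single (Fin.castAdd h a) 1 +
        ∑ c ∈ V ∪ V', Finsupp.single (Fin.natAdd h c) 1)
        ((∑ U ∈ V.powerset, monomial (∑ a ∈ (∅ : Finset (Fin h)), Finsupp.single (Fin.castAdd h a) 1 +
            ∑ c ∈ U, Finsupp.single (Fin.natAdd h c) 1)
            ((-1 : ℂ) ^ U.card * (U.card.factorial : ℂ) * ∏ c ∈ U, γ V c)) *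
          (∑ U ∈ V'.powerset, monomial (∑ a ∈ (∅ : Finset (Fin h)), Finsupp.single (Fin.castAdd h a) 1 +
            ∑ c ∈ U, Finsupp.single (Fin.natAdd h c) 1)
            ((-1 : ℂ) ^ U.card * (U.card.factorial : ℂ) * ∏ c ∈ U, γ V' c))) =
      ((-1 : ℂ) ^ V.card * (V.card.factorial : ℂ) * ∏ c ∈ V, γ V c) *
        ((-1 : ℂ) ^ V'.card * (V'.card.factorial : ℂ) * ∏ c ∈ V', γ V' c) := by
  classical
  rw [coeff_partitionExpo_mul_yOnly _ _ (yOnly_tinvG γ V') ∅ (V ∪ V')]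
  rw [← Finset.add_sum_erase _ _ (Finset.mem_powerset.mpr Finset.subset_union_right)]
  rw [coeff_tinvG, coeff_tinvG, Finset.union_sdiff_cancel_right hd, if_pos (subset_refl _),
    if_pos (subset_refl _)]
  rw [Finset.sum_eq_zero, add_zero]
  intro X₁ hX₁
  rw [Finset.mem_erase, Finset.mem_powerset] at hX₁
  rw [coeff_tinvG, coeff_tinvG]
  by_cases h2 : X₁ ⊆ V'
  · have h1 : ¬ ((V ∪ V') \ X₁ ⊆ V) := by
      intro hsub
      apply hX₁.1
      refine le_antisymm h2 fun c hc => ?_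
      by_contra hcX
      have hcV : c ∈ V := hsub (Finset.mem_sdiff.mpr ⟨Finset.mem_union_right _ hc, hcX⟩)
      exact Finset.disjoint_left.mp hd hcV hc
    rw [if_neg h1, zero_mul]
  · rw [if_neg h2, mul_zero]

end Summit.ValiantsHypothesis.ValiantsHypothesis.Theorems.BarrierLever.ChowThinAll
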